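import Summits.CriticalPhenomena.PercolationContinuityZ3.Theorems.Transplant.TranslationInvariantSubperiodic
import Summits.CriticalPhenomena.PercolationContinuityZ3.Theorems.Transplant.Slab111Scope
import HarnessLib

/-!
# Every FILM `{a ≤ ⟨v, x⟩ ≤ b}` — ANY Miller index `v ≠ 0`, any thickness — of every periodic graph on `ℤ^d`, `d ≥ 3`, dies at its own critical point
# (modulo film-connectedness): `p_c < 1` and `θ_x(p_c) = 0` at every vertex; in particular every `(hkl)`-film of every Kesten-periodic net on `ℤ³`

builds on p205010 (kernel theorem, internal audit signed; external expert review pending).  Lane `prim-bschramm`, seat `prim-bschramm-stmt`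
gen 37 (statements seat; by-name customer of the rung-Q node); helper file (`--supports stmt-CriticalPhenomena-4575 --as helper`); PROOFS ONLY (def-free).

THE POINT.  The master lemma «TranslationInvariantSubperiodic» p588574 (`TransInv.induce_conj4_of_subperiodic`: every connected sub-periodic induced
subgraph of a graph on `ℤ^d` invariant under an injected `ℤ^e`, `e ≥ 2`, with finitely many orbits) instantiated ONCE for the whole crystallographic
family of films.  Data: `G` locally finite on `Site d = ℤ^d`, `d ≥ 3`, invariant under the SUBLATTICE `N ℤ^d` (`G.Adj (x + N • u) (y + N • u) ↔ G.Adj x y`,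
`N ≠ 0` — `N = 1` for translation-invariant graphs, `N = n₀ n₁ n₂` for a Kesten-periodic net with periods `nᵢ eᵢ`); a normal vector `v : ℤ^d`, `v ≠ 0`;
levels `a b : ℤ`; the film `F = {x | a ≤ v ⬝ᵥ x ≤ b}` (Mathlib's `dotProduct`).  If `G[F]` is connected then **`p_c(x) < 1` and `θ_x(p_c(x)) = 0` at every
vertex `x` of `G[F]`** — `TransInv.linearFilm_conj4_of_sublatticeInv`; `N = 1`: `TransInv.linearFilm_conj4_holds`; every periodic net on `ℤ³`
(«Z3NetDefs», `N.Periodic n`, positive periods): **`Z3Net.linearFilm_conj4_of_periodic`**.  THE INSTANCE: pick a coordinate `i` with `v i ≠ 0`; the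
in-film period vectors are `φ a = N • ((v i) ι a − ⟨v', a⟩ e_i)` (`ι = Fin.insertNth i 0`, `v' = v ∘ i.succAbove`), an injective additive map
`ℤ^{d-1} →+ ℤ^d` with `v ⬝ᵥ φ a = 0` and image in `N ℤ^d`; the orbit representatives are the film points whose coordinates off `i` lie in
`[0, |N v i|)` — finitely many, since `(v ⬝ᵥ x, x off i)` determines `x` (`v i ≠ 0`) and ranges in `[a, b] × [0, |N v i|)^{d-1}`; every film point
reduces to one by Euclidean division of its coordinates off `i` by `N v i`.  No basis of `v^⊥ ∩ ℤ^d`, no Smith normal form, no coprimality of `v` is needed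
(a finite-index sublattice of the film lattice suffices for the node).
SCOPE.  `v = e_i`: the axis films of p588574 (`TransInv.axisFilm_conj4_holds`) and, for `i = 0`, the slabs of p587615; `v = (1,1,1)`, `d = 3`, `G = ℤ³`:
TARGET 2x's `(111)`-films `Slab111OwnCriticalContinuity k` (of record `slab111OwnCriticalContinuity_holds` p559127; re-derived below as a regression
`example` for `k ≥ 1`, no new decl); `v = e₂`, Kesten-periodic nets: the `(001)`-film umbrella p573626.  NEW CONTENT: every other Miller index — all
`(hkl)`-films of `ℤ³`, of the 1 024 unit-range cubic lattices, of fcc/bcc/diamond-type and every other Kesten-periodic net in the C1b catalogue, and all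
rational-hyperplane films of every periodic graph on `ℤ^d`, `d ≥ 4` — each modulo the connectedness of the film, which stays a HYPOTHESIS (NECESSARY as
stated: thin oblique films are often disconnected, e.g. the `(111)`-film of `ℤ³` of thickness `0`, the two-layer diamond film p563640).  PRINT STATUS
(FRESHNESS wording): in print only `ℤ² × {0,…,k}` / `ℤ² × G₀` (Duminil-Copin–Sidoravicius–Tassion 2016) and the honeycomb-type thin films that ARE planar
lattices; nothing found in print for oblique films of thickness `≥ 2` or for any film in `d ≥ 4`; nearest-neighbour `ℤ^d`'s own `θ(p_c) = 0` (`d ≥ 3`) is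
the lane's KERNEL THEOREM p205010 (internal audit signed; external expert review pending), NOT in print.  Not a `@[conjecture]` node of the tree.  Nothing
is claimed at the ambient graph's critical point, nor about Conj. 4 beyond these periodic instances, nor about the end state.
[cite: Kesten1982, §2.1 Def. 1 and Ch. 3 (periodic graphs)] [cite: BenjaminiSchramm1996, Conj. 4; §2; Question 3]
[cite: DuminilCopinSidoraviciusTassion2016, Thm. 1 + p. 3 "Two generalizations"] [cite: GrimmettPercolation1999, §7.2 p. 148 (`p_c(A)` of an induced subgraph)]
[cite: KozmaNitzan2024, Thm. 6 (p. 15)]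
-/

noncomputable section

namespace Summit.CriticalPhenomena.PercolationContinuityZ3.Theorems

namespace Transplant

open SimpleGraph Literature.Probability.LatticeModels Literature.Probability.Percolation
open scoped Classical

namespace TransInv

variable {d : ℕ} (G : SimpleGraph (Site d))

/-- **Every CONNECTED film `{a ≤ v ⬝ᵥ x ≤ b}` (`v ≠ 0`, any levels) of every locally finite graph on `ℤ^d`, `d ≥ 3`, invariant under a sublattice
`N ℤ^d` (`N ≠ 0`), has `p_c < 1` and dies at its own critical point, at every vertex** — the master lemma `induce_conj4_of_subperiodic` with the in-film
period vectors `φ a = N • ((v i) ι a − ⟨v', a⟩ e_i)` for a coordinate `i` with `v i ≠ 0` and the finitely many film points reduced off `i` modulo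
`|N v i|`.  Film-connectedness is a hypothesis. builds on p205010 (kernel theorem, internal audit signed; external expert review pending).
[cite: Kesten1982, §2.1 Def. 1; Ch. 3] [cite: BenjaminiSchramm1996, Conj. 4; §2] -/
theorem linearFilm_conj4_of_sublatticeInv (hd : 3 ≤ d) [G.LocallyFinite] {N : ℤ} (hN : N ≠ 0)
    (hT : ∀ u x y : Site d, G.Adj (x + N • u) (y + N • u) ↔ G.Adj x y) {v : Site d} (hv : v ≠ 0) (a b : ℤ)
    (hc : (G.induce {x : Site d | a ≤ v ⬝ᵥ x ∧ v ⬝ᵥ x ≤ b}).Connected) (x : {x : Site d | a ≤ v ⬝ᵥ x ∧ v ⬝ᵥ x ≤ b}) :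
    criticalProb (G.induce {x : Site d | a ≤ v ⬝ᵥ x ∧ v ⬝ᵥ x ≤ b}) x < 1 ∧
      theta (G.induce {x : Site d | a ≤ v ⬝ᵥ x ∧ v ⬝ᵥ x ≤ b}) x
        (criticalProbIOf (G.induce {x : Site d | a ≤ v ⬝ᵥ x ∧ v ⬝ᵥ x ≤ b}) x) = 0 := by
  obtain ⟨e, rfl⟩ : ∃ e, d = e + 1 := ⟨d - 1, by omega⟩
  have he : 2 ≤ e := by omega
  obtain ⟨i, hi⟩ : ∃ i, v i ≠ 0 := Function.ne_iff.1 hv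
  let F : Set (Site (e + 1)) := {z : Site (e + 1) | a ≤ v ⬝ᵥ z ∧ v ⬝ᵥ z ≤ b}
  set m : ℤ := N * v i with hm
  have hm0 : m ≠ 0 := mul_ne_zero hN hi
  -- the in-film period vectors: `ψ a = (v i) a − ⟨v', a⟩ e_i` off / on the `i`-th coordinate, `φ a = N • ψ a`
  let ψ : Site e → Site (e + 1) := fun a' =>
    Fin.insertNth (α := fun _ => ℤ) i (-(∑ j, v (i.succAbove j) * a' j)) (fun j => v i * a' j)
  have hψi : ∀ a', ψ a' i = -(∑ j, v (i.succAbove j) * a' j) := fun a' =>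
    Fin.insertNth_apply_same (α := fun _ => ℤ) i _ _
  have hψs : ∀ a' j, ψ a' (i.succAbove j) = v i * a' j := fun a' j =>
    Fin.insertNth_apply_succAbove (α := fun _ => ℤ) i _ _ j
  let φ : Site e →+ Site (e + 1) :=
    { toFun := fun a' => N • ψ a'
      map_zero' := by
        funext l
        rcases Fin.eq_self_or_eq_succAbove i l with rfl | ⟨j, rfl⟩
        · rw [Pi.smul_apply, hψi]; simp
        · rw [Pi.smul_apply, hψs]; simp
      map_add' := fun a' b' => by
        funext l
        rcases Fin.eq_self_or_eq_succAbove i l with rfl | ⟨j, rfl⟩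
        · rw [Pi.add_apply, Pi.smul_apply, Pi.smul_apply, Pi.smul_apply, hψi, hψi, hψi]
          simp only [Pi.add_apply, mul_add, Finset.sum_add_distrib, smul_eq_mul]; ring
        · rw [Pi.add_apply, Pi.smul_apply, Pi.smul_apply, Pi.smul_apply, hψs, hψs, hψs]
          simp only [Pi.add_apply, smul_eq_mul]; ring }
  have hφi : ∀ a', φ a' i = N * -(∑ j, v (i.succAbove j) * a' j) := fun a' => by
    change (N • ψ a') i = _; rw [Pi.smul_apply, hψi, smul_eq_mul]
  have hφs : ∀ a' j, φ a' (i.succAbove j) = N * (v i * a' j) := fun a' j => by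
    change (N • ψ a') (i.succAbove j) = _; rw [Pi.smul_apply, hψs, smul_eq_mul]
  -- `φ a` lies in the film's direction lattice `v^⊥`
  have hvφ : ∀ a', v ⬝ᵥ φ a' = 0 := by
    intro a'
    rw [dotProduct, Fin.sum_univ_succAbove _ i, hφi]
    have hs : ∑ j, v (i.succAbove j) * φ a' (i.succAbove j) = N * v i * ∑ j, v (i.succAbove j) * a' j := by
      rw [Finset.mul_sum]
      exact Finset.sum_congr rfl fun j _ => by rw [hφs]; ring
    rw [hs]; ring
  have hφ : Function.Injective φ := fun a' b' h => by
    funext j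
    have h' := congrFun h (i.succAbove j)
    rw [hφs, hφs] at h'
    exact mul_left_cancel₀ hi (mul_left_cancel₀ hN h')
  have hT' : ∀ (a' : Site e) (x y : Site (e + 1)), G.Adj (x + φ a') (y + φ a') ↔ G.Adj x y := fun a' x y => hT (ψ a') x y
  have hF : ∀ (a' : Site e) (z : Site (e + 1)), z ∈ F → z + φ a' ∈ F := by
    intro a' z hz
    simp only [F, Set.mem_setOf_eq, dotProduct_add, hvφ, add_zero] at hz ⊢
    exact hz
  -- orbit representatives: film points with reduced coordinates off `i`
  let R : Set (Site (e + 1)) := {z | z ∈ F ∧ ∀ j, 0 ≤ z (i.succAbove j) ∧ z (i.succAbove j) < |m|}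
  have hRF : R ⊆ F := fun z hz => hz.1
  have hR : R.Finite := by
    refine Set.Finite.of_finite_image (f := fun z : Site (e + 1) => (v ⬝ᵥ z, Fin.removeNth i z)) ?_ ?_
    · refine ((Set.finite_Icc a b).prod (Set.Finite.pi fun _ : Fin e => Set.finite_Ico (0 : ℤ) |m|)).subset ?_
      rintro _ ⟨z, hz, rfl⟩
      exact Set.mk_mem_prod ⟨hz.1.1, hz.1.2⟩ (Set.mem_univ_pi.2 fun j => ⟨(hz.2 j).1, (hz.2 j).2⟩)
    · intro z _ y _ hzy
      simp only [Prod.mk.injEq] at hzy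
      obtain ⟨h1, h2⟩ := hzy
      have h2' : ∀ j, z (i.succAbove j) = y (i.succAbove j) := fun j => congrFun h2 j
      funext l
      rcases Fin.eq_self_or_eq_succAbove i l with hl | ⟨j, rfl⟩
      · rw [hl]
        rw [dotProduct, dotProduct, Fin.sum_univ_succAbove _ i, Fin.sum_univ_succAbove (fun l => v l * y l) i] at h1
        have hs : ∑ j, v (i.succAbove j) * z (i.succAbove j) = ∑ j, v (i.succAbove j) * y (i.succAbove j) :=
          Finset.sum_congr rfl fun j _ => by rw [h2' j]
        rw [hs] at h1
        exact mul_left_cancel₀ hi (add_right_cancel h1)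
      · exact h2' j
  have hcover : ∀ w ∈ F, ∃ a' : Site e, ∃ r ∈ R, r + φ a' = w := by
    intro w hw
    refine ⟨fun j => w (i.succAbove j) / m, w - φ (fun j => w (i.succAbove j) / m), ⟨?_, fun j => ?_⟩, sub_add_cancel _ _⟩
    · have h' := hF (-(fun j => w (i.succAbove j) / m)) w hw
      rwa [map_neg, ← sub_eq_add_neg] at h'
    · rw [Pi.sub_apply, hφs, ← mul_assoc, ← hm, ← Int.emod_def]
      exact ⟨Int.emod_nonneg _ hm0, Int.emod_lt_abs _ hm0⟩
  exact induce_conj4_of_subperiodic G he φ hφ hT' hF hR hRF hcover hc x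

/-- **Every CONNECTED film `{a ≤ v ⬝ᵥ x ≤ b}` (`v ≠ 0`) of every locally finite TRANSLATION-INVARIANT graph on `ℤ^d`, `d ≥ 3`, has `p_c < 1` and dies
at its own critical point, at every vertex** (`N = 1`).  `v = e_i`: the axis films (p588574) and slabs (p587615). builds on p205010 (kernel theorem,
internal audit signed; external expert review pending). [cite: BenjaminiSchramm1996, Conj. 4; §2] [cite: DuminilCopinSidoraviciusTassion2016, Thm. 1] -/
theorem linearFilm_conj4_holds (hd : 3 ≤ d) [G.LocallyFinite] (hT : ∀ u x y : Site d, G.Adj (x + u) (y + u) ↔ G.Adj x y)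
    {v : Site d} (hv : v ≠ 0) (a b : ℤ)
    (hc : (G.induce {x : Site d | a ≤ v ⬝ᵥ x ∧ v ⬝ᵥ x ≤ b}).Connected) (x : {x : Site d | a ≤ v ⬝ᵥ x ∧ v ⬝ᵥ x ≤ b}) :
    criticalProb (G.induce {x : Site d | a ≤ v ⬝ᵥ x ∧ v ⬝ᵥ x ≤ b}) x < 1 ∧
      theta (G.induce {x : Site d | a ≤ v ⬝ᵥ x ∧ v ⬝ᵥ x ≤ b}) x
        (criticalProbIOf (G.induce {x : Site d | a ≤ v ⬝ᵥ x ∧ v ⬝ᵥ x ≤ b}) x) = 0 :=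
  linearFilm_conj4_of_sublatticeInv G hd one_ne_zero (fun u x y => by rw [one_smul]; exact hT u x y) hv a b hc x

end TransInv

/-! ## Every periodic net on `ℤ³`: films of every Miller index -/

namespace Z3Net

/-- **Every CONNECTED `(hkl)`-film `{a ≤ v ⬝ᵥ x ≤ b}` (`v ≠ 0`, any thickness) of every Kesten-PERIODIC NET on `ℤ³` (positive periods) has `p_c < 1` and
dies at its own critical point, at every vertex** — sublattice `N ℤ³` with `N = n₀ n₁ n₂` inside the period lattice.  `v = e₂`: the `(001)`-film umbrella
`film_conj4_of_periodic` (p573626).  Film-connectedness is a hypothesis. builds on p205010 (kernel theorem, internal audit signed; external expert review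
pending). [cite: Kesten1982, §2.1 Def. 1] [cite: BenjaminiSchramm1996, Conj. 4; §2; Question 3] [cite: DuminilCopinSidoraviciusTassion2016, p. 3] -/
theorem linearFilm_conj4_of_periodic (N : Z3Net) {n : Fin 3 → ℕ} (h : N.Periodic n) (hn : ∀ i, 0 < n i)
    {v : Site 3} (hv : v ≠ 0) (a b : ℤ)
    (hc : (N.graph.induce {x : Site 3 | a ≤ v ⬝ᵥ x ∧ v ⬝ᵥ x ≤ b}).Connected) (x : {x : Site 3 | a ≤ v ⬝ᵥ x ∧ v ⬝ᵥ x ≤ b}) :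
    criticalProb (N.graph.induce {x : Site 3 | a ≤ v ⬝ᵥ x ∧ v ⬝ᵥ x ≤ b}) x < 1 ∧
      theta (N.graph.induce {x : Site 3 | a ≤ v ⬝ᵥ x ∧ v ⬝ᵥ x ≤ b}) x
        (criticalProbIOf (N.graph.induce {x : Site 3 | a ≤ v ⬝ᵥ x ∧ v ⬝ᵥ x ≤ b}) x) = 0 := by
  have hM : ((n 0 * n 1 * n 2 : ℕ) : ℤ) ≠ 0 := by
    exact_mod_cast Nat.mul_ne_zero (Nat.mul_ne_zero (hn 0).ne' (hn 1).ne') (hn 2).ne'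
  refine TransInv.linearFilm_conj4_of_sublatticeInv N.graph le_rfl hM (fun u x y => ?_) hv a b hc x
  have hmem : ((n 0 * n 1 * n 2 : ℕ) : ℤ) • u ∈ periodLattice n := by
    intro j
    rw [Pi.smul_apply, smul_eq_mul]
    refine Dvd.dvd.mul_right ?_ _
    fin_cases j
    · exact_mod_cast dvd_mul_of_dvd_left (dvd_mul_right (n 0) (n 1)) (n 2)
    · exact_mod_cast dvd_mul_of_dvd_left (dvd_mul_left (n 1) (n 0)) (n 2)
    · exact_mod_cast dvd_mul_left (n 2) (n 0 * n 1)
  exact ⟨fun hxy => by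
    have := N.adj_add_right h (neg_mem_periodLattice hmem) hxy
    rwa [add_neg_cancel_right, add_neg_cancel_right] at this, N.adj_add_right h hmem⟩

end Z3Net

/-! ## Regression: the `(111)`-films of `ℤ³` -/

/-- Regression (no new declaration): TARGET 2x's `(111)`-node `Slab111OwnCriticalContinuity k` (`k ≥ 1`; of record `slab111OwnCriticalContinuity_holds`,
p559127) re-derived from the linear-film umbrella with `v = (1,1,1)`, `a = 0`, `b = k`. -/
example (k : ℕ) (hk : 1 ≤ k) : Slab111OwnCriticalContinuity k := by
  have hS : slab111 k = {x : Site 3 | 0 ≤ ![(1 : ℤ), 1, 1] ⬝ᵥ x ∧ ![(1 : ℤ), 1, 1] ⬝ᵥ x ≤ k} := by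
    ext x
    rw [mem_slab111, Set.mem_setOf_eq]
    simp [dotProduct, Fin.sum_univ_three, add_assoc]
  have hc := Slab111.connected hk
  unfold Slab111OwnCriticalContinuity Slab111.film at hc ⊢
  rw [hS] at hc ⊢
  intro w
  have hv : (![(1 : ℤ), 1, 1] : Site 3) ≠ 0 := fun h0 => by simpa using congrFun h0 0
  exact (TransInv.linearFilm_conj4_holds (zdGraph 3) le_rfl (fun u x y => zdGraph_adj_shift_iff u x y) hv 0 k hc w).2

end Transplant

end Summit.CriticalPhenomena.PercolationContinuityZ3.Theorems

end
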